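import Mathlib
import Summits.Ventures.PercRepro2.Defs
import Summits.Ventures.PercRepro2.Graph
import Summits.Ventures.PercRepro2.Events
import Summits.Ventures.PercRepro2.Harris
import Summits.Ventures.PercRepro2.FourFunctions
import Summits.Ventures.PercRepro2.XWForm

/-!
# The coincidence `u = o` of (XW) is an Ahlswede–Daykin instance (PercRepro2, p2 g24)

With `o = u` the three events of (XW) are `a = {s ↔ u}`, `λ = {y ↔ u}`, `S = {s ↔ y}` and every
product of two of them is the full connection `F = {s, u, y in one cluster}` (`aλ = Sa = Sλ = F`),
so `XW = P(F)·P(Q) + P(F)² − P(a)P(λ)`.  Splitting `a = F ⊔ A₁`, `λ = F ⊔ B₁` with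
`A₁ = {s ↔ u, y ↮ u}`, `B₁ = {y ↔ u, s ↮ u}` and `D₀ = {s ↮ y, s ↮ u, y ↮ u}` (the three marks
pairwise separated), `A₁ ⊔ B₁ ⊔ D₀ ⊆ Q` gives
`XW ≥ P(F)·P(D₀) − P(A₁)·P(B₁)`, and the four functions theorem (`prob_mul_prob_le_of_sup_inf`,
p1's `FourFunctions.lean`) closes it: `ω ∈ A₁`, `ω' ∈ B₁` force `ω ⊔ ω' ∈ F` and `ω ⊓ ω' ∈ D₀`.
In partition language this is **`P(suy)·P(s|u|y) ≥ P(su|y)·P(uy|s)`** for three marks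
(P2-G24-XWGEN.md §4).  Together with `XWCoincide.lean` (p2 g23: `s = u`, `y = o` identities,
`u = y`, `o = s` Harris) and the trivial `s = y` (`xwBil_eq_zero_of_s_eq_y`), every coincidence of
two of the four marks of (XW) is settled on every graph.  Own work; standard axioms.
-/

namespace Summit.Ventures.PercRepro2

namespace XWCoincideUO

variable {V : Type*} {E : Type*} [Fintype E] [DecidableEq E]
  {R : Type*} [CommRing R] [LinearOrder R] [IsStrictOrderedRing R]

omit [LinearOrder R] [IsStrictOrderedRing R] in
/-- The coincidence `s = y`: `S` is the full space and (XW) is the identity `0 = 0`. -/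
theorem xwBil_eq_zero_of_s_eq_y (ends : E → Sym2 V) (s o u : V) (p : E → R) :
    xwBil ends s s o u p p = 0 := by
  unfold xwBil
  have h : connEvent ends s s = Set.univ := Set.eq_univ_of_forall fun ω => conn_refl ends ω s
  rw [h, Set.univ_inter, Set.univ_inter, prob_univ]
  ring

omit [Fintype E] [DecidableEq E] [LinearOrder R] [IsStrictOrderedRing R] in
/-- `{s ↔ u} ∩ {y ↔ u}` is the full connection `{s ↔ y} ∩ {s ↔ u} ∩ {y ↔ u}`. -/
lemma inter_a_l_eq (ends : E → Sym2 V) (s y u : V) :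
    connEvent ends s u ∩ connEvent ends y u =
      connEvent ends s y ∩ connEvent ends s u ∩ connEvent ends y u := by
  ext ω
  simp only [Set.mem_inter_iff, connEvent, Set.mem_setOf_eq]
  constructor
  · rintro ⟨hsu, hyu⟩
    exact ⟨⟨conn_trans hsu (conn_symm hyu), hsu⟩, hyu⟩
  · rintro ⟨⟨_, hsu⟩, hyu⟩
    exact ⟨hsu, hyu⟩

omit [Fintype E] [DecidableEq E] [LinearOrder R] [IsStrictOrderedRing R] in
/-- `{s ↔ y} ∩ {s ↔ u}` is the full connection. -/
lemma inter_S_a_eq (ends : E → Sym2 V) (s y u : V) :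
    connEvent ends s y ∩ connEvent ends s u =
      connEvent ends s y ∩ connEvent ends s u ∩ connEvent ends y u := by
  ext ω
  simp only [Set.mem_inter_iff, connEvent, Set.mem_setOf_eq]
  constructor
  · rintro ⟨hsy, hsu⟩
    exact ⟨⟨hsy, hsu⟩, conn_trans (conn_symm hsy) hsu⟩
  · rintro ⟨⟨hsy, hsu⟩, _⟩
    exact ⟨hsy, hsu⟩

omit [Fintype E] [DecidableEq E] [LinearOrder R] [IsStrictOrderedRing R] in
/-- `{s ↔ y} ∩ {y ↔ u}` is the full connection. -/
lemma inter_S_l_eq (ends : E → Sym2 V) (s y u : V) :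
    connEvent ends s y ∩ connEvent ends y u =
      connEvent ends s y ∩ connEvent ends s u ∩ connEvent ends y u := by
  ext ω
  simp only [Set.mem_inter_iff, connEvent, Set.mem_setOf_eq]
  constructor
  · rintro ⟨hsy, hyu⟩
    exact ⟨⟨hsy, conn_trans hsy hyu⟩, hyu⟩
  · rintro ⟨⟨hsy, _⟩, hyu⟩
    exact ⟨hsy, hyu⟩

omit [Fintype E] [DecidableEq E] [LinearOrder R] [IsStrictOrderedRing R] in
/-- **The four-functions input**: `s ↔ u, y ↮ u` in `ω` and `y ↔ u, s ↮ u` in `ω'` force the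
full connection in `ω ⊔ ω'` and the three marks pairwise separated in `ω ⊓ ω'`. -/
lemma sup_inf_of_mem (ends : E → Sym2 V) (s y u : V) :
    ∀ ω ∈ connEvent ends s u ∩ (connEvent ends y u)ᶜ,
      ∀ ω' ∈ connEvent ends y u ∩ (connEvent ends s u)ᶜ,
        ω ⊔ ω' ∈ connEvent ends s y ∩ connEvent ends s u ∩ connEvent ends y u ∧
        ω ⊓ ω' ∈ (connEvent ends s y)ᶜ ∩ (connEvent ends s u)ᶜ ∩ (connEvent ends y u)ᶜ := by
  rintro ω ⟨hsu, hyu⟩ ω' ⟨hyu', hsu'⟩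
  have hsu : Conn ends ω s u := hsu
  have hyu : ¬ Conn ends ω y u := hyu
  have hyu' : Conn ends ω' y u := hyu'
  have hsu' : ¬ Conn ends ω' s u := hsu'
  have h1 : Conn ends (ω ⊔ ω') s u := conn_mono le_sup_left hsu
  have h2 : Conn ends (ω ⊔ ω') y u := conn_mono le_sup_right hyu'
  refine ⟨⟨⟨conn_trans h1 (conn_symm h2), h1⟩, h2⟩, ⟨⟨?_, ?_⟩, ?_⟩⟩
  · intro h
    exact hyu (conn_trans (conn_symm (conn_mono inf_le_left h)) hsu)
  · intro h
    exact hsu' (conn_mono inf_le_right h)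
  · intro h
    exact hyu (conn_mono inf_le_left h)

/-- **The coincidence `u = o` of (XW)**: `0 ≤ xwBil ends s y u u p p`, i.e.
`P(suy)·P(Q) + P(suy)² ≥ P(s ↔ u)·P(y ↔ u)`, by the four functions theorem on
`A₁ = {s ↔ u, y ↮ u}`, `B₁ = {y ↔ u, s ↮ u}` (`P(A₁)P(B₁) ≤ P(F)P(D₀)`). -/
theorem xwBil_nonneg_of_u_eq_o (ends : E → Sym2 V) (s y u : V) {p : E → R} (hp : IsProbVec p) :
    0 ≤ xwBil ends s y u u p p := by
  unfold xwBil
  set S := connEvent ends s y with hS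
  set a := connEvent ends s u with ha
  set l := connEvent ends y u with hl
  set F := S ∩ a ∩ l with hF
  have hal : a ∩ l = F := inter_a_l_eq ends s y u
  have hSa : S ∩ a = F := inter_S_a_eq ends s y u
  have hSl : S ∩ l = F := inter_S_l_eq ends s y u
  rw [hal, hSa, hSl]
  -- split `a` and `λ` along the full connection
  have h1 : prob p (a ∩ l) + prob p (a ∩ lᶜ) = prob p a := prob_inter_add_prob_inter_compl p a l
  have h2 : prob p (l ∩ a) + prob p (l ∩ aᶜ) = prob p l := prob_inter_add_prob_inter_compl p l a
  rw [hal] at h1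
  rw [Set.inter_comm, hal] at h2
  -- the three pieces of `Q`
  set A₁ := a ∩ lᶜ with hA₁
  set B₁ := l ∩ aᶜ with hB₁
  set D₀ := Sᶜ ∩ aᶜ ∩ lᶜ with hD₀
  have hdisj1 : Disjoint A₁ B₁ := by
    rw [Set.disjoint_left]
    rintro ω ⟨hω, _⟩ ⟨_, hω'⟩
    exact hω' hω
  have hdisj2 : Disjoint (A₁ ∪ B₁) D₀ := by
    rw [Set.disjoint_left]
    rintro ω (⟨hω, _⟩ | ⟨hω, _⟩) ⟨⟨_, hω'⟩, hω''⟩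
    · exact hω' hω
    · exact hω'' hω
  have hsub : A₁ ∪ B₁ ∪ D₀ ⊆ Sᶜ := by
    rintro ω ((⟨hsu, hyu⟩ | ⟨hyu, hsu⟩) | ⟨⟨hQ, _⟩, _⟩)
    · intro hsy
      exact hyu (conn_trans (conn_symm hsy) hsu)
    · intro hsy
      exact hsu (conn_trans hsy hyu)
    · exact hQ
  have hQ : prob p A₁ + prob p B₁ + prob p D₀ ≤ prob p Sᶜ := by
    rw [← prob_union_of_disjoint p hdisj1, ← prob_union_of_disjoint p hdisj2]
    exact prob_mono hp hsub
  have hAD : prob p A₁ * prob p B₁ ≤ prob p F * prob p D₀ :=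
    prob_mul_prob_le_of_sup_inf hp (sup_inf_of_mem ends s y u)
  have hc : prob p Sᶜ = 1 - prob p S := prob_compl p S
  have hF0 : 0 ≤ prob p F := prob_nonneg hp F
  have hD0 : 0 ≤ prob p D₀ := prob_nonneg hp D₀
  have hkey : 0 ≤ prob p F * (prob p Sᶜ - prob p A₁ - prob p B₁ - prob p D₀) :=
    mul_nonneg hF0 (by linarith)
  rw [← h1, ← h2]
  nlinarith [hkey, hAD, hc]

end XWCoincideUO

end Summit.Ventures.PercRepro2
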